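import Mathlib.RingTheory.DiscreteValuationRing.Basic
import Mathlib.Algebra.Module.Torsion.Free
import Mathlib.LinearAlgebra.Span.Basic
import Mathlib.LinearAlgebra.Pi
import Mathlib.LinearAlgebra.Quotient.Basic
import Mathlib.LinearAlgebra.Finsupp.LinearCombination
import HarnessLib

/-!
# The pulled-back differentials of a dilatation of affine space: a module-theoretic model

Topic: `Literature/AlgebraicGeometry/Smoothening` (Bosch–Lütkebohmert–Raynaud, *Néron Models*,
§3.2–3.3). Let `R` be a discrete valuation ring with uniformizer `π`, `Z = Spec B` with
`B = R[T₁, …, T_N]`, and let `Z' = Spec B[g₁/π, …, g_r/π]` be the dilatation of `Z` in the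
centre `V(π, g₁, …, g_r)` of the special fibre. Presenting `Z'` by `B[Z₁, …, Z_r]/(π Zⱼ - gⱼ)`,
the pull-back of `Ω¹_{Z'/R}` along an `S`-valued point `a'` of `Z'` lifting a point `a` of `Z`
(`S` a discrete valuation ring of ramification index one over `R`) is the quotient of
`a*Ω¹_{Z/R} ⊕ Sʳ = F ⊕ Sʳ` by the relation vectors `ρⱼ = (-dgⱼ(a), π eⱼ)` coming from
`d(π Zⱼ - gⱼ)`. This file records the three properties of that quotient `F'` and of the map
`D : F → F'`, `x ↦ [(x, 0)]`, that feed the torsion-drop inequality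
(`Smoothening/TorsionDrop`):

* `dilatationRelations γ π` — the span of the `ρⱼ = (-γ j, π eⱼ)`; `dilatationMap γ π = D`;
* `dilatationMap_injective` — `D` is injective (`π` a non-zero-divisor);
* `exists_dilatationMap_eq_smul` — `π F' ⊆ D(F)`: `π [(x, w)] = D (π x + Σ wⱼ γⱼ)`;
* `isTorsionFree_dilatationQuot` — `F'` is torsion-free (hence free) as soon as the residues
  of the `γⱼ` modulo `π` are linearly independent (the centre is smooth: `dḡⱼ(a_k)` linearly
  independent), `F` being torsion-free.

Pure module theory over a discrete valuation ring; [folklore] bookkeeping, no named facts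
(D-0026).

## References

* S. Bosch, W. Lütkebohmert, M. Raynaud, *Néron Models*, Springer 1990, §3.2 (dilatations),
  §3.3 Prop. 5. [BLRNeronModels1990] (Not held; numbers only.)
* M. Artin, *Néron Models*, in: G. Cornell, J. H. Silverman (eds.), *Arithmetic Geometry*,
  Springer 1986, proof of Lemma (3.9), step (f): "Blow up `Y` by the substitution `pz = x`"
  (p. 227). [Artin1986NeronModels]
-/

open Module Submodule

namespace Literature.AlgebraicGeometry.Smoothening

universe u v w

variable {S : Type u} [CommRing S] {F : Type v} [AddCommGroup F] [Module S F]
  {ι : Type w} [DecidableEq ι]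

/-- The relation vectors `ρⱼ = (-γⱼ, π eⱼ) ∈ F ⊕ Sᶥ` of a dilatation (the differentials
`d(π Zⱼ - gⱼ)` pulled back to the lifted point) and their span. [folklore] -/
def dilatationRelations (γ : ι → F) (π : S) : Submodule S (F × (ι → S)) :=
  span S (Set.range fun j => ((-(γ j), Pi.single j π) : F × (ι → S)))

/-- The map `D : F → F' = (F ⊕ Sᶥ) ⧸ ⟨ρⱼ⟩`, `x ↦ [(x, 0)]` (the differential of the dilatation
at the lifted point). [folklore] -/
def dilatationMap (γ : ι → F) (π : S) :
    F →ₗ[S] (F × (ι → S)) ⧸ dilatationRelations γ π :=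
  (dilatationRelations γ π).mkQ ∘ₗ LinearMap.inl S F (ι → S)

/-- `D x = [(x, 0)]`. [folklore] -/
theorem dilatationMap_apply (γ : ι → F) (π : S) (x : F) :
    dilatationMap γ π x = (dilatationRelations γ π).mkQ (x, 0) := rfl

/-- Membership in the span of the relation vectors: `(x, w) ∈ ⟨ρⱼ⟩` iff
`(x, w) = (-Σ cⱼ γⱼ, π c)` for some `c`. [folklore] -/
theorem mem_dilatationRelations_iff [Fintype ι] (γ : ι → F) (π : S) (p : F × (ι → S)) :
    p ∈ dilatationRelations γ π ↔ ∃ c : ι → S, p = (-(∑ j, c j • γ j), fun j => π * c j) := by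
  rw [dilatationRelations, Submodule.mem_span_range_iff_exists_fun]
  have key : ∀ c : ι → S, (∑ j, c j • ((-(γ j), Pi.single j π) : F × (ι → S))) =
      (-(∑ j, c j • γ j), fun j => π * c j) := by
    intro c
    ext
    · simp [Prod.fst_sum, Finset.sum_neg_distrib]
    · rename_i i
      simp [Prod.snd_sum, Pi.single_apply, mul_comm]
  constructor
  · rintro ⟨c, rfl⟩; exact ⟨c, key c⟩
  · rintro ⟨c, rfl⟩; exact ⟨c, key c⟩

/-- Each relation vector `ρⱼ` lies in their span. [folklore] -/
theorem single_mem_dilatationRelations (γ : ι → F) (π : S) (j : ι) :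
    ((-(γ j), Pi.single j π) : F × (ι → S)) ∈ dilatationRelations γ π :=
  Submodule.subset_span ⟨j, rfl⟩

/-- `D` is injective as soon as `π` is a non-zero-divisor of `S`. [folklore] -/
theorem dilatationMap_injective [Fintype ι] (γ : ι → F) {π : S} (hπ : IsRegular π) :
    Function.Injective (dilatationMap γ π) := by
  rw [← LinearMap.ker_eq_bot, Submodule.eq_bot_iff]
  intro x hx
  rw [LinearMap.mem_ker, dilatationMap_apply, Submodule.mkQ_apply,
    Submodule.Quotient.mk_eq_zero, mem_dilatationRelations_iff] at hx
  obtain ⟨c, hc⟩ := hx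
  have hc0 : c = 0 := by
    funext j
    have := congrArg (fun p : F × (ι → S) => p.2 j) hc
    simp only [Pi.zero_apply] at this
    exact hπ.left (by simpa using this.symm)
  have := congrArg Prod.fst hc
  simpa [hc0] using this

/-- `π F' ⊆ D(F)`: `π [(x, w)] = D (π x + Σ wⱼ γⱼ)`. [folklore] -/
theorem exists_dilatationMap_eq_smul [Fintype ι] (γ : ι → F) (π : S)
    (q : (F × (ι → S)) ⧸ dilatationRelations γ π) :
    ∃ x : F, dilatationMap γ π x = π • q := by
  obtain ⟨⟨x, w⟩, rfl⟩ := Submodule.mkQ_surjective _ q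
  refine ⟨π • x + ∑ j, w j • γ j, ?_⟩
  rw [dilatationMap_apply, ← map_smul, Submodule.mkQ_apply, Submodule.mkQ_apply,
    Submodule.Quotient.eq, mem_dilatationRelations_iff]
  refine ⟨-w, ?_⟩
  ext
  · simp
  · simp

/-- `F'` is `π`-torsion-free when the residues of the `γⱼ` modulo `π` are linearly independent
(stated as: `Σ cⱼ γⱼ ∈ π F` forces `π ∣ cⱼ`) and `F` is torsion-free. [folklore] -/
theorem isSMulRegular_dilatationQuot [Fintype ι] [IsDomain S] [Module.IsTorsionFree S F] (γ : ι → F)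
    {π : S} (hπ0 : π ≠ 0)
    (hγ : ∀ c : ι → S, (∃ y : F, ∑ j, c j • γ j = π • y) → ∀ j, π ∣ c j) :
    IsSMulRegular ((F × (ι → S)) ⧸ dilatationRelations γ π) π := by
  have hreg : IsRegular π := IsRegular.of_ne_zero hπ0
  intro q q' hqq'
  simp only at hqq'
  rw [← sub_eq_zero, ← smul_sub] at hqq'
  rw [← sub_eq_zero]
  generalize q - q' = p at hqq'
  obtain ⟨⟨x, w⟩, rfl⟩ := Submodule.mkQ_surjective _ p
  rw [Submodule.mkQ_apply, ← Submodule.Quotient.mk_smul, Submodule.Quotient.mk_eq_zero,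
    mem_dilatationRelations_iff] at hqq'
  obtain ⟨c, hc⟩ := hqq'
  have hw : w = c := by
    funext j
    have := congrArg (fun p : F × (ι → S) => p.2 j) hc
    exact hreg.left (by simpa using this)
  subst hw
  have hx : π • x = -(∑ j, w j • γ j) := by simpa using congrArg Prod.fst hc
  -- the residues being independent, every `w j` is divisible by `π`
  have hdiv : ∀ j, π ∣ w j := hγ w ⟨-x, by rw [smul_neg, hx, neg_neg]⟩
  choose w' hw' using hdiv
  have hx' : x = -(∑ j, w' j • γ j) := by
    apply hreg.smul_right_injective F
    simp only [hx, smul_neg, Finset.smul_sum, ← mul_smul, ← hw']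
  rw [Submodule.mkQ_apply, Submodule.Quotient.mk_eq_zero, mem_dilatationRelations_iff]
  exact ⟨w', by ext <;> simp [hx', hw']⟩

/-- Over a discrete valuation ring, `π`-torsion-free modules are torsion-free. [folklore] -/
theorem isTorsionFree_of_isSMulRegular [IsDomain S] [IsDiscreteValuationRing S] {π : S}
    (hπ : Irreducible π) {Q : Type v} [AddCommGroup Q] [Module S Q] (h : IsSMulRegular Q π) :
    Module.IsTorsionFree S Q := by
  refine ⟨fun r hr => ?_⟩
  have hr0 : r ≠ 0 := hr.ne_zero
  obtain ⟨n, u, rfl⟩ := IsDiscreteValuationRing.eq_unit_mul_pow_irreducible hr0 hπ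
  exact (Units.isSMulRegular Q u).mul (h.pow n)

/-- **`F'` is torsion-free** (hence free of rank `rank F`, being finitely generated over a
principal ideal domain) when the centre is smooth at the point, i.e. the residues of the `γⱼ`
modulo `π` are linearly independent, and `F` is torsion-free. [folklore] -/
theorem isTorsionFree_dilatationQuot [Fintype ι] [IsDomain S] [IsDiscreteValuationRing S]
    [Module.IsTorsionFree S F] (γ : ι → F) {π : S} (hπ : Irreducible π)
    (hγ : ∀ c : ι → S, (∃ y : F, ∑ j, c j • γ j = π • y) → ∀ j, π ∣ c j) :
    Module.IsTorsionFree S ((F × (ι → S)) ⧸ dilatationRelations γ π) :=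
  isTorsionFree_of_isSMulRegular hπ (isSMulRegular_dilatationQuot γ hπ.ne_zero hγ)

end Literature.AlgebraicGeometry.Smoothening
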